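import Mathlib
import Summits.Ventures.PercRepro.TriangleCapSquareSum
import Summits.Ventures.PercRepro.TriangleCapThreeRowSecondBestCherries

/-!
# PercRepro — THE CHERRY BOUND FOR TRIANGLE-FREE GRAPHS WITH BOUNDED DEGREE (p3, gen 55; part 311)

The square-sum bound of part 299 in the lane's original currency: every triangle-free graph with `s ≤ D²` edges and
every degree `≤ D` has

  **`2 · cherries + 2 s ≤ sqMax s D`**,  i.e.  `cherries ≤ m C(D,2) + C(r,2) + D C(m,2) + m r`   (`s = m D + r`)

(`cherries_le_sqMax`, `two_mul_cherries_le_nest`: `2 cherries ≤ m D (D − 1) + r (r − 1) + D m (m − 1) + 2 m r`) — the number of paths of length two is at most that of the nested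
bipartite configuration `K_{D,m}` plus a column of `r` (the `m` full columns give `m C(D,2)`, the partial column
`C(r,2)`, the `r` rows of length `m + 1` and `D − r` of length `m` give `r C(m+1,2) + (D − r) C(m,2) = D C(m,2) + m r`),
with `2 cherries + Σ d = Σ d²` (part 152).  In the lane's table language: on the cells `k ≥ …` with `m ≤ D²` edges the
`K₄⁻`-free (even the triangle-free) maximum of cherries under a degree bound `D` is the nested configuration — the
degree-bounded analogue of part 140's envelope `cherries ≤ m (k − 2)/2`.  Axioms: standard.
-/

namespace PercRepro

namespace TriangleCap

namespace C047

open Finset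

variable {V : Type*} [Fintype V] [DecidableEq V]

/-- **THE CHERRY BOUND:** `2 · cherries H + 2 s ≤ sqMax s D` for every triangle-free `H` with `s ≤ D²` edges and every
degree `≤ D`. -/
theorem cherries_le_sqMax (H : SimpleGraph V) [DecidableRel H.Adj] (hfree : H.CliqueFree 3) (s D : ℕ)
    (hs : H.edgeFinset.card = s) (hD : ∀ v, deg H v ≤ D) (hsD : s ≤ D * D) :
    2 * cherries H + 2 * s ≤ sqMax s D := by
  have h1 := two_mul_cherries_add H
  have h2 := sum_deg_eq H
  have h3 := sum_deg_sq_le_sqMax D s H hfree hs hD hsD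
  rw [hs] at h2
  omega

/-- The nested cherry count: `sqNest m r D = [m D (D − 1) + r (r − 1) + D m (m − 1) + 2 m r] + 2 (m D + r)` — twice the
cherries of the nested configuration plus twice its edges. -/
theorem sqNest_eq_nest (m r D : ℕ) :
    sqNest m r D = m * (D * (D - 1)) + r * (r - 1) + D * (m * (m - 1)) + 2 * (m * r) + 2 * (m * D + r) := by
  have e1 := mul_self_eq_mul_pred_add D
  have e2 := mul_self_eq_mul_pred_add r
  have e3 := mul_self_eq_mul_pred_add m
  unfold sqNest
  set X := D * (D - 1) with hX
  set Y := r * (r - 1) with hY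
  set Z := m * (m - 1) with hZ
  zify at e1 e2 e3 ⊢
  linear_combination (m : ℤ) * e1 + e2 + (D : ℤ) * e3

/-- **THE CHERRY BOUND OF THE NESTED CONFIGURATION:** `2 · cherries H ≤ m D (D − 1) + r (r − 1) + D m (m − 1) + 2 m r`
(twice `m C(D,2) + C(r,2) + D C(m,2) + m r`) for `s = m D + r`, `r < D`, `s ≤ D²`, every degree `≤ D`, triangle-free. -/
theorem two_mul_cherries_le_nest (H : SimpleGraph V) [DecidableRel H.Adj] (hfree : H.CliqueFree 3) (s m r D : ℕ)
    (hs : H.edgeFinset.card = s) (hD : ∀ v, deg H v ≤ D) (hsm : s = m * D + r) (hr : r < D) (hsD : s ≤ D * D) :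
    2 * cherries H ≤ m * (D * (D - 1)) + r * (r - 1) + D * (m * (m - 1)) + 2 * (m * r) := by
  have h := cherries_le_sqMax H hfree s D hs hD hsD
  rw [sqMax_eq s D m r (by omega) hsm hr, sqNest_eq_nest, hsm] at h
  omega

end C047

end TriangleCap

end PercRepro
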